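import Summits.ABC.IUTFork.Joshi.Arithmeticoids
import Mathlib.Analysis.SpecialFunctions.Log.Basic
import Mathlib.Data.Finsupp.Basic
import Mathlib.Algebra.BigOperators.Finsupp.Basic

/-!
# Joshi, *ATS II½ — Deformations of Number Fields* (arXiv:2305.10398) §4.5, §5.3–§5.4, §5.10, §5.14: the adelic
# `B`-rings, normalized arithmeticoids, ideloids and degrees, THE PERIOD MAPPING `y ↦ H_y` (Thm. 5.10.1), the Frobenioid of `L`

Companion of `Joshi/Arithmeticoids.lean` (block E, rung LADDER-ABC:A2.E, seat abc-iut-E-t37, slot T-37; same source, render and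
conventions: [J-2½] = K. Joshi, arXiv:2305.10398, lit key `paper:arxiv-2305.10398`, bib `Joshi2023ATS2half`, «p.N l.M» = line M of
`HOME/plan/repair/lit/renders/Joshi-arxiv-2305.10398-ATS2half/pNNNN.txt`). TAKES NO SIDE on [IUTchIII] Cor. 3.12, on Joshi's
claims, or on Mochizuki's reports on them; typed ≠ proved; typed AS A CANDIDATE ≠ endorsed; every statement print ASSERTS is a
`def … : Prop` with `@[claim "Joshi2023ATS2half" "disputed"]`, never an axiom / instance / theorem; what FOLLOWS from the typed
signature is a proved `theorem` (DISCHARGED row).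

CONTENTS (node ids of `HOME/plan/E/JOSHI-DAG.tsv`):
* J2h:Def4.5.1 — signature `BRingDatum` (the rings `B_{L_v} ⊃ B^+_{L_v}`, `ϕ_v`, `π_v` of [FF18, Ch. 2] as Joshi invokes them,
  §4.5 p.26 l.39 – p.27 l.23) and the CONSTRUCTIONS `BL = B_L = ∏_v B_{L_v}` (product ring, product topology), `BLplus = B^+_L`
  (the cofinite condition — a subring, DERIVED), `eigen v = B^{ϕ=π_v}_{L_v}`, `BLone = B_L(1) = ∏_v B^{ϕ=π_v}_{L_v}`.
* §5.3 (p.32 l.9 – p.33 l.7) — `iota`, the normalized valuations `|−|^{α_v}_{K_{y_v}}` and (5.3.4) `prod_formula_normalized`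
  (DERIVED from the signature's product formula (5.3.2) and (5.3.3)); Def. 5.4.1 `adeloid` (a set) / `ideloid` (a subgroup of
  `∏_v K_v*`, DERIVED), Lem. 5.4.2 `unitMul` (the `L*`-action, DERIVED: `iotaUnits_mem_ideloid`), Def. 5.4.3 `deg`, Lem. 5.4.4
  `deg_unitMul` (DERIVED).
* J2h:Thm5.10.1 — (1) `logMap` (+ `logMap_mul`, DERIVED), (2) `deg_eq_sum_logMap` (DERIVED), (3)/(4) `hyperplane` with
  `logCoords_mem_hyperplane` and `deg_iotaUnits` (DERIVED from the product formula), (5) = `deg_unitMul`, (6) definitional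
  (`periodMap_unitAction`), (7) `periodMap` + the claim `PeriodMapNonconstant`, (8) prose. LOCATED for the faithfulness lane (no
  verdict; the same item seat E-t8 raised on [J-III] Thm. 4.6.1): in (1) the normalization exponent `α_v` sits INSIDE the
  coordinates (`log|x_v|^{α_v}`), in (4) it appears as WEIGHTS on coordinates `z_v` (`Σ_v α_v·z_v = 0`); both are typed —
  `logMap` as (1) prints it, `hyperplane` as (4) prints it, `logCoords` = the unweighted vector that (4) weights — and
  `sum_logMap_eq_weighted_logCoords` relates them.
* J2h:Def5.14.1 — `PhiL`, `PhiLgp`, `divL`: the Frobenioid `Frob(L) = (L*, Φ(L), L* → Φ(L)^gp)` of [FrdI, Ex. 6.3] as printed,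
  typed over `V^non` through `ord_v` (LOCATED: print's `⊕_{v ∈ V_L}` includes archimedean `v`, where `𝒪_{L_v}` is not defined
  in the paper).
NOT HERE: Cor. 4.6.1 (actions on `B_L`), Def. 5.14.2 / Prop. 5.15.1 (Frobenioid of an arithmeticoid), §5.16 (realified
Frobenioids) — not cross-cited on the S-spine (E-PLAN R11). OUR SIDE (BY NAME, docstring only; R14): print's degree /
log-volume vocabulary `Summit.ABC.IUTFork.Thm311.GlobalDegrees` is the dictionary row seat E-t8 proposed for [J-III] Rmk. 4.6.2 (3);
nothing is bound here.
-/

noncomputable section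

open TopologicalSpace

namespace Summit.ABC.IUTFork.Joshi.ATS2h

namespace DeformationDatum

variable {L : Type} [Field L] {V : Type} {Lv : V → Type} [∀ v, Field (Lv v)] {Y : V → Type}
  [∀ v, TopologicalSpace (Y v)] {K : (v : V) → Y v → Type} [∀ v y, Field (K v y)] [∀ v y, TopologicalSpace (K v y)]
  {G : V → Type} [∀ v, Group (G v)] {A : V → Type} [∀ v, Group (A v)]
  (D : DeformationDatum L V Lv Y K G A)

/-! ## §4.5 The global topological rings `B_L ⊃ B^+_L` (Def. 4.5.1) -/

/-- **SIGNATURE for [J-2½] §4.5** (p.26 l.39 – p.27 l.1; HYPOTHESIS structure, nothing asserted): for each `v`, «`B_{L_v}` the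
ring constructed in [FF18, Chapitre 2]» (an `L_v`-algebra with a topology — carriers are parameters), «`B^{ϕ=π_v}_{L_v} ⊂ B_{L_v}`
the Banach subspace on which Frobenius operates by multiplication by `π_v`», a uniformizer `π_v ∈ 𝒪_{L_v}`, the Frobenius
`ϕ_v` of `B_{L_v}` (`L_v`-linear, [FF18]); for `v ∈ V^arc`: «`B_{ℂ^♭_v,L}` the Banach algebra constructed in the archimedean
setting, `B^+ = B`, and one takes `π_v = 1` and `ϕ_v = 1`» (p.26 l.56–69). [claim: Joshi2023ATS2half, status: disputed] -/
structure BRingDatum (B : V → Type) [∀ v, CommRing (B v)] [∀ v, TopologicalSpace (B v)] [∀ v, Algebra (Lv v) (B v)] :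
    Type where
  /-- `B^+_{L_v} ⊂ B_{L_v}` ([FF18, Déf. 1.10.7]; `= B` at `v ∈ V^arc`) -/
  Bplus : (v : V) → Subring (B v)
  /-- `B^+ = B` at archimedean `v` (p.26 l.60–63) -/
  Bplus_arch : ∀ v, v ∈ D.Varc → Bplus v = ⊤
  /-- the Frobenius `ϕ_v` of `B_{L_v}` -/
  frobB : (v : V) → B v →+* B v
  /-- `ϕ_v` is `L_v`-linear ([FF18, Ch. 2]) -/
  frobB_algebraMap : ∀ v (r : Lv v), frobB v (algebraMap (Lv v) (B v) r) = algebraMap (Lv v) (B v) r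
  /-- `ϕ_v = 1` at archimedean `v` (p.26 l.64) -/
  frobB_arch : ∀ v, v ∈ D.Varc → frobB v = RingHom.id (B v)
  /-- a uniformizer `π_v ∈ 𝒪_{L_v}` (p.26 l.44–46) -/
  unif : (v : V) → Lv v
  /-- `π_v = 1` at archimedean `v` (p.26 l.64) -/
  unif_arch : ∀ v, v ∈ D.Varc → unif v = 1

namespace BRingDatum

variable {D} {B : V → Type} [∀ v, CommRing (B v)] [∀ v, TopologicalSpace (B v)] [∀ v, Algebra (Lv v) (B v)]
  (R : D.BRingDatum B)

/-- **[J-2½] Def. 4.5.1** (p.27 l.1–6): «the adelic `B`-ring … is the ring, equipped with the product topology,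
`B_L = ∏_{v ∈ V_L} B_{L_v}`» (product ring and topology are the instance ones). Rmk. 4.5.2: «one should think of `B_L` as
functions on `𝒴_L`». [claim: Joshi2023ATS2half, status: disputed] -/
abbrev BL (_R : D.BRingDatum B) : Type := (v : V) → B v

/-- **[J-2½] Def. 4.5.1** (p.27 l.7–14): «`B^+_L = {(x_v) ∈ B_L : x_v ∈ B^+_{L_v} for all but finitely many v}`» — a subring
of `B_L` (closure under the ring operations DERIVED from the cofinite filter). Rmk. 4.5.2: «functions on `𝒴_L` which are bounded
at all but finitely many primes». [claim: Joshi2023ATS2half, status: disputed] -/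
def BLplus : Subring R.BL where
  carrier := {x | ∀ᶠ v in Filter.cofinite, x v ∈ R.Bplus v}
  mul_mem' := fun {a b} (ha : ∀ᶠ v in Filter.cofinite, a v ∈ R.Bplus v) (hb : ∀ᶠ v in Filter.cofinite, b v ∈ R.Bplus v) =>
    show ∀ᶠ v in Filter.cofinite, (a * b) v ∈ R.Bplus v from (ha.and hb).mono fun _ h => mul_mem h.1 h.2
  one_mem' := show ∀ᶠ v in Filter.cofinite, (1 : R.BL) v ∈ R.Bplus v from
    Filter.Eventually.of_forall fun v => one_mem (R.Bplus v)
  add_mem' := fun {a b} (ha : ∀ᶠ v in Filter.cofinite, a v ∈ R.Bplus v) (hb : ∀ᶠ v in Filter.cofinite, b v ∈ R.Bplus v) =>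
    show ∀ᶠ v in Filter.cofinite, (a + b) v ∈ R.Bplus v from (ha.and hb).mono fun _ h => add_mem h.1 h.2
  zero_mem' := show ∀ᶠ v in Filter.cofinite, (0 : R.BL) v ∈ R.Bplus v from
    Filter.Eventually.of_forall fun v => zero_mem (R.Bplus v)
  neg_mem' := fun {a} (ha : ∀ᶠ v in Filter.cofinite, a v ∈ R.Bplus v) =>
    show ∀ᶠ v in Filter.cofinite, (-a) v ∈ R.Bplus v from ha.mono fun _ h => neg_mem h

/-- `B^{ϕ=π_v}_{L_v} ⊂ B_{L_v}` (p.26 l.52–55): «the Banach subspace on which Frobenius operates by multiplication by `π_v`»,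
an `L_v`-subspace (closure under scalars from the `L_v`-linearity of `ϕ_v`); `= B` at `v ∈ V^arc` (p.26 l.64–69).
[claim: Joshi2023ATS2half, status: disputed] -/
def eigen (v : V) : Submodule (Lv v) (B v) where
  carrier := {x | R.frobB v x = algebraMap (Lv v) (B v) (R.unif v) * x}
  add_mem' hx hy := by
    simp only [Set.mem_setOf_eq] at hx hy ⊢
    rw [map_add, hx, hy, mul_add]
  zero_mem' := by simp
  smul_mem' r x hx := by
    simp only [Set.mem_setOf_eq] at hx ⊢
    rw [Algebra.smul_def, map_mul, R.frobB_algebraMap, hx]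
    ring

/-- At archimedean `v`, `B^{ϕ_v=π_v}_{L_v} = B_{L_v}` (p.26 l.64–69: `π_v = 1`, `ϕ_v = 1`). DERIVED. [claim: Joshi2023ATS2half,
status: disputed] -/
theorem eigen_arch {v : V} (hv : v ∈ D.Varc) : R.eigen v = ⊤ := by
  ext x
  simp only [eigen, Submodule.mem_mk, AddSubmonoid.mem_mk, AddSubsemigroup.mem_mk, Set.mem_setOf_eq, Submodule.mem_top,
    iff_true]
  rw [R.frobB_arch v hv, R.unif_arch v hv]
  simp

/-- **[J-2½] Def. 4.5.1** (p.27 l.15–20): «`B_L(1) = ∏_{v ∈ V_L} B^{ϕ=π_v}_{L_v}`» ⊂ `B_L`. [claim: Joshi2023ATS2half, status: disputed] -/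
def BLone : AddSubgroup R.BL := AddSubgroup.pi Set.univ fun v => (R.eigen v).toAddSubgroup

/-- Membership in `B_L(1)` is coordinatewise. [claim: Joshi2023ATS2half, status: disputed] -/
theorem mem_BLone_iff (x : R.BL) : x ∈ R.BLone ↔ ∀ v, R.frobB v (x v) = algebraMap (Lv v) (B v) (R.unif v) * x v := by
  simp [BLone, AddSubgroup.mem_pi, eigen]

end BRingDatum

/-! ## §5.3 Normalizing valuations; §5.4 adeloids, ideloids and the degree (Def. 5.4.1, Lem. 5.4.2, Def. 5.4.3, Lem. 5.4.4) -/

/-- `ι_{y_v} : L ↪ L_v ↪ K_{y_v}`, the `v`-component of Lem. 5.1.3's `ι_L`. [claim: Joshi2023ATS2half, status: disputed] -/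
def iota (y : D.Arith) (v : V) : L →+* K v (y v) := (D.emb v (y v)).comp (D.toLv v)

/-- `ι_{y_v}(x) ≠ 0` for `x ∈ L*` (field homomorphisms are injective). [folklore] -/
theorem iota_ne_zero (y : D.Arith) (v : V) (x : Lˣ) : D.iota y v (x : L) ≠ 0 :=
  (map_ne_zero_iff _ (D.iota y v).injective).2 x.ne_zero

/-- `|ι_{y_v}(x)|_{K_{y_v}} > 0` for `x ∈ L*`. [folklore] -/
theorem absK_iota_pos (y : D.Arith) (v : V) (x : Lˣ) : 0 < D.absK v (y v) (D.iota y v x) :=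
  (D.absK_isValuedField v (y v)).pos_of_ne_zero (D.iota_ne_zero y v x)

/-- (5.3.3) on `L*`: `α_v·log|ι(x)|_{K_{y_v}} = log|x|_v`. DERIVED. [claim: Joshi2023ATS2half, status: disputed] -/
theorem alpha_mul_log_absK_iota (y : D.Arith) (v : V) (x : Lˣ) :
    D.α v (y v) * Real.log (D.absK v (y v) (D.iota y v x)) = Real.log (D.absLv v (D.toLv v x)) := by
  rw [D.absLv_eq_rpow v (y v), ← Real.log_rpow (D.absK_iota_pos y v x)]
  rfl

/-- **(5.3.4) DERIVED** (p.32 l.29–44; (5.8.2) p.36 l.20–27): in the NORMALIZED arithmeticoid `arith(L)^nor_y` the product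
formula reads `∏_v |x|^{α_v}_{K_{ξ_v}} = 1`, i.e. `Σ_v α_v·log|ι(x)|_{K_{y_v}} = 0` for `x ∈ L*` — from (5.3.2) and (5.3.3).
[claim: Joshi2023ATS2half, status: disputed] -/
theorem prod_formula_normalized (y : D.Arith) (x : Lˣ) :
    ∑ᶠ v, D.α v (y v) * Real.log (D.absK v (y v) (D.iota y v x)) = 0 := by
  simp_rw [D.alpha_mul_log_absK_iota y]
  exact D.sum_log_absLv x

/-- If `|x|_v = 1` then `|ι(x)|_{K_{y_v}} = 1` (`α_v > 0`). [folklore] -/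
theorem absK_iota_eq_one (y : D.Arith) (v : V) (x : Lˣ) (h : D.absLv v (D.toLv v x) = 1) :
    D.absK v (y v) (D.iota y v x) = 1 := by
  have hpos := D.absK_iota_pos y v x
  have hlog : D.α v (y v) * Real.log (D.absK v (y v) (D.iota y v x)) = 0 := by
    rw [D.alpha_mul_log_absK_iota, h, Real.log_one]
  rcases mul_eq_zero.1 hlog with hα | hl
  · exact absurd hα (D.α_pos v (y v)).ne'
  · rcases Real.log_eq_zero.1 hl with h0 | h1 | hm1
    · exact absurd h0 hpos.ne'
    · exact h1
    · linarith

/-- The set of places where `|ι(x)|_{K_{y_v}} ≠ 1` is finite, for `x ∈ L*` (from the product formula's finiteness).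
[folklore] -/
theorem finite_absK_iota_ne_one (y : D.Arith) (x : Lˣ) : {v | D.absK v (y v) (D.iota y v x) ≠ 1}.Finite :=
  (D.finite_absLv_ne_one x).subset fun v hv h => hv (D.absK_iota_eq_one y v x h)

/-- **[J-2½] Def. 5.4.1, adeloid** (p.33 l.9–18): «`Adeloid_{arith(L)} = {(x_v) ∈ ∏_v K_v : x_v ∈ 𝒪_{K_v} for all but
finitely many v}`», with `𝒪_{K_v} = {|−|_{K_v} ≤ 1}` — typed as a SUBSET of the arithmetic ring (Lem. 5.4.2 «the adeloid is a
topological ring»: LOCATED — at an archimedean `v` with `|−|_{K_v} = |−|^s_ℂ`, `{|−| ≤ 1}` is not closed under addition; no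
verdict). [claim: Joshi2023ATS2half, status: disputed] -/
def adeloid (y : D.Arith) : Set (D.arithRing y) := {x | ∀ᶠ v in Filter.cofinite, D.absK v (y v) (x v) ≤ 1}

/-- **[J-2½] Def. 5.4.1, ideloid** (p.33 l.19–29): «`Ideloid_{arith(L)} = {(x_v) ∈ ∏_v K_v* : x_v ∈ 𝒪*_{K_v} for all but
finitely many v}`» (`𝒪*_{K_v} = {|−|_{K_v} = 1}`), a subgroup of `∏_v K_v*` — Lem. 5.4.2 «is a topological group»: the group
structure DERIVED (multiplicativity of `|−|_{K_v}`). [claim: Joshi2023ATS2half, status: disputed] -/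
def ideloid (y : D.Arith) : Subgroup ((v : V) → (K v (y v))ˣ) where
  carrier := {z | ∀ᶠ v in Filter.cofinite, D.absK v (y v) (z v : K v (y v)) = 1}
  mul_mem' := fun {z w} (hz : ∀ᶠ v in Filter.cofinite, D.absK v (y v) (z v : K v (y v)) = 1)
      (hw : ∀ᶠ v in Filter.cofinite, D.absK v (y v) (w v : K v (y v)) = 1) =>
    show ∀ᶠ v in Filter.cofinite, D.absK v (y v) ((z * w) v : K v (y v)) = 1 from
      (hz.and hw).mono fun v h => by
        rw [Pi.mul_apply, Units.val_mul, (D.absK_isValuedField v (y v)).map_mul, h.1, h.2, mul_one]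
  one_mem' := show ∀ᶠ v in Filter.cofinite, D.absK v (y v) ((1 : (v : V) → (K v (y v))ˣ) v : K v (y v)) = 1 from
    Filter.Eventually.of_forall fun v => by
      rw [Pi.one_apply, Units.val_one, (D.absK_isValuedField v (y v)).map_one]
  inv_mem' := fun {z} (hz : ∀ᶠ v in Filter.cofinite, D.absK v (y v) (z v : K v (y v)) = 1) =>
    show ∀ᶠ v in Filter.cofinite, D.absK v (y v) (z⁻¹ v : K v (y v)) = 1 from
      hz.mono fun v h => by
        rw [Pi.inv_apply, Units.val_inv_eq_inv_val, (D.absK_isValuedField v (y v)).map_inv, h, inv_one]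

/-- Membership in the ideloid is the printed cofinite unit condition. [claim: Joshi2023ATS2half, status: disputed] -/
theorem mem_ideloid_iff (y : D.Arith) (z : (v : V) → (K v (y v))ˣ) :
    z ∈ D.ideloid y ↔ ∀ᶠ v in Filter.cofinite, D.absK v (y v) (z v : K v (y v)) = 1 := Iff.rfl

/-- The diagonal `L* → ∏_v K_v*`, `x ↦ (ι_{y_v}(x))_v` (Lem. 5.4.2's `x·(z_v) = (x·z_v)`, p.33 l.33–35). [claim: Joshi2023ATS2half,
status: disputed] -/
def iotaUnits (y : D.Arith) : Lˣ →* ((v : V) → (K v (y v))ˣ) := MonoidHom.pi fun v => Units.map (D.iota y v).toMonoidHom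

/-- `(ι(x))_v` has `v`-coordinate `ι_{y_v}(x)`. [claim: Joshi2023ATS2half, status: disputed] -/
@[simp] theorem iotaUnits_apply (y : D.Arith) (x : Lˣ) (v : V) : (D.iotaUnits y x v : K v (y v)) = D.iota y v x := rfl

/-- `ι(L*) ⊂ Ideloid` — the content of **Lem. 5.4.2**'s `L*`-action (p.33 l.30–36): DERIVED from the product formula's
finiteness and (5.3.3). [claim: Joshi2023ATS2half, status: disputed] -/
theorem iotaUnits_mem_ideloid (y : D.Arith) (x : Lˣ) : D.iotaUnits y x ∈ D.ideloid y := by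
  rw [mem_ideloid_iff, Filter.eventually_cofinite]
  simpa using D.finite_absK_iota_ne_one y x

/-- **[J-2½] Lem. 5.4.2** (p.33 l.30–36): the multiplicative action `L* × Ideloid → Ideloid`, `(x, (z_v)) ↦ (x·z_v)`.
[claim: Joshi2023ATS2half, status: disputed] -/
def unitMul (y : D.Arith) (x : Lˣ) (z : D.ideloid y) : D.ideloid y :=
  ⟨D.iotaUnits y x * z, mul_mem (D.iotaUnits_mem_ideloid y x) z.2⟩

/-- **[J-2½] Def. 5.4.3** (p.33 l.37–48): the (normalized) ARITHMETIC DEGREE `deg_y : Ideloid → ℝ`,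
`deg_y((x_v)) = Σ_v log|x_v|^{α_v}_{K_v}` («a finite sum by the definition of an ideloid»); typed on all of `∏_v K_v*` as a
`finsum` (junk value `0` off finite support; on the ideloid the support is finite, `deg_support_finite`). [claim:
Joshi2023ATS2half, status: disputed] -/
def deg (y : D.Arith) (z : (v : V) → (K v (y v))ˣ) : ℝ := ∑ᶠ v, D.α v (y v) * Real.log (D.absK v (y v) (z v : K v (y v)))

/-- On the ideloid the degree is a genuine finite sum. [claim: Joshi2023ATS2half, status: disputed] -/
theorem deg_support_finite (y : D.Arith) (z : D.ideloid y) :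
    (Function.support fun v => D.α v (y v) * Real.log (D.absK v (y v) ((z : (v : V) → (K v (y v))ˣ) v : K v (y v)))).Finite := by
  have h := z.2
  rw [mem_ideloid_iff, Filter.eventually_cofinite] at h
  exact h.subset fun v hv h1 => hv (by simp [h1])

/-- **[J-2½] Thm. 5.10.1 (3), literal form** / (5.3.4): `deg_y((ι(x))_v) = 0` for `x ∈ L*` — «`H_y : deg_y((x)_v) =
Σ_v log|x|^{α_v}_{K_{y_v}} = 0` (for all `x ∈ L*`)» (p.38 l.13–23). DERIVED. [claim: Joshi2023ATS2half, status: disputed] -/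
theorem deg_iotaUnits (y : D.Arith) (x : Lˣ) : D.deg y (D.iotaUnits y x) = 0 := by
  simpa [deg] using D.prod_formula_normalized y x

/-- **[J-2½] Lem. 5.4.4** (p.33 l.49 – p.34 l.4) = **Thm. 5.10.1 (5)**: «`deg_y(x·(z_v)) = deg_y((z_v))` for all `x ∈ L*` … the
normalized arithmetic degree descends to `Ideloid/L* → ℝ`» — DERIVED from the product formula (5.3.4). [claim: Joshi2023ATS2half,
status: disputed] -/
theorem deg_unitMul (y : D.Arith) (x : Lˣ) (z : D.ideloid y) :
    D.deg y (D.unitMul y x z : (v : V) → (K v (y v))ˣ) = D.deg y z := by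
  have hfx : (Function.support fun v => D.α v (y v) * Real.log (D.absK v (y v) (D.iota y v x))).Finite :=
    (D.finite_absK_iota_ne_one y x).subset fun v hv h1 => hv (by simp [h1])
  have hfz := D.deg_support_finite y z
  have hsplit : ∀ v, D.α v (y v) * Real.log (D.absK v (y v) ((D.unitMul y x z : (v : V) → (K v (y v))ˣ) v : K v (y v))) =
      D.α v (y v) * Real.log (D.absK v (y v) (D.iota y v x)) +
        D.α v (y v) * Real.log (D.absK v (y v) ((z : (v : V) → (K v (y v))ˣ) v : K v (y v))) := by
    intro v
    have hz : 0 < D.absK v (y v) ((z : (v : V) → (K v (y v))ˣ) v : K v (y v)) :=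
      (D.absK_isValuedField v (y v)).pos_of_ne_zero ((z : (v : V) → (K v (y v))ˣ) v).ne_zero
    simp only [unitMul, Pi.mul_apply, Units.val_mul, iotaUnits_apply, (D.absK_isValuedField v (y v)).map_mul]
    rw [Real.log_mul (D.absK_iota_pos y v x).ne' hz.ne', mul_add]
  simp only [deg, hsplit]
  rw [finsum_add_distrib hfx hfz, D.prod_formula_normalized y x, zero_add]

/-! ## §5.10 The product formula as a global arithmetic period mapping (Thm. 5.10.1) -/

/-- **[J-2½] Thm. 5.10.1 (1)** (p.37 l.26–41): `V_L = ⊕_{v ∈ V_L} ℝ_v` is `V →₀ ℝ`, and «the ideloid provides a homomorphism of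
groups `log_{arith(L)_y} : Ideloid → V_L`, `(x_v) ↦ (log|x_v|^{α_v}_{K_{y_v}})_v`» (finitely supported on the ideloid).
[claim: Joshi2023ATS2half, status: disputed] -/
def logMap (y : D.Arith) (z : D.ideloid y) : V →₀ ℝ :=
  Finsupp.ofSupportFinite
    (fun v => Real.log (D.absK v (y v) ((z : (v : V) → (K v (y v))ˣ) v : K v (y v)) ^ D.α v (y v)))
    (by
      have h := z.2
      rw [mem_ideloid_iff, Filter.eventually_cofinite] at h
      exact h.subset fun v hv h1 => hv (by simp [h1]))

/-- The `v`-coordinate of `log_y(z)` is `log|z_v|^{α_v} = α_v·log|z_v|`. [claim: Joshi2023ATS2half, status: disputed] -/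
theorem logMap_apply (y : D.Arith) (z : D.ideloid y) (v : V) :
    D.logMap y z v = D.α v (y v) * Real.log (D.absK v (y v) ((z : (v : V) → (K v (y v))ˣ) v : K v (y v))) := by
  have hz : 0 < D.absK v (y v) ((z : (v : V) → (K v (y v))ˣ) v : K v (y v)) :=
    (D.absK_isValuedField v (y v)).pos_of_ne_zero ((z : (v : V) → (K v (y v))ˣ) v).ne_zero
  simp [logMap, Finsupp.ofSupportFinite_coe, Real.log_rpow hz]

/-- Thm. 5.10.1 (1) «homomorphism of groups» DERIVED: `log_y(z·w) = log_y(z) + log_y(w)`. [claim: Joshi2023ATS2half, status: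
disputed] -/
theorem logMap_mul (y : D.Arith) (z w : D.ideloid y) : D.logMap y (z * w) = D.logMap y z + D.logMap y w := by
  ext v
  have hz : 0 < D.absK v (y v) ((z : (v : V) → (K v (y v))ˣ) v : K v (y v)) :=
    (D.absK_isValuedField v (y v)).pos_of_ne_zero ((z : (v : V) → (K v (y v))ˣ) v).ne_zero
  have hw : 0 < D.absK v (y v) ((w : (v : V) → (K v (y v))ˣ) v : K v (y v)) :=
    (D.absK_isValuedField v (y v)).pos_of_ne_zero ((w : (v : V) → (K v (y v))ˣ) v).ne_zero
  simp only [logMap_apply, Finsupp.add_apply, Subgroup.coe_mul, Pi.mul_apply, Units.val_mul,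
    (D.absK_isValuedField v (y v)).map_mul]
  rw [Real.log_mul hz.ne' hw.ne', mul_add]

/-- **[J-2½] Thm. 5.10.1 (2)** (p.37 l.42 – p.38 l.9) DERIVED: `deg_y = (Σ_v) ∘ log_y`,
«`(x_v) ↦ (log|x_v|^{α_v})_v ↦ Σ_v log(|x_v|^{α_v}) = deg_y((x_v))`». [claim: Joshi2023ATS2half, status: disputed] -/
theorem deg_eq_sum_logMap (y : D.Arith) (z : D.ideloid y) :
    D.deg y z = (D.logMap y z).sum fun _ r => r := by
  rw [Finsupp.sum, deg]
  rw [finsum_eq_sum_of_support_subset _ (s := (D.logMap y z).support) ?_]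
  · exact Finset.sum_congr rfl fun v _ => (D.logMap_apply y z v).symm
  · intro v hv
    simpa [Finsupp.mem_support_iff, logMap_apply] using hv

/-- The UNWEIGHTED log vector `(log|ι(x)|_{K_{y_v}})_v ∈ V_L` of `x ∈ L*` — the coordinates `z_v` that Thm. 5.10.1 (4) weights by
`α_v`. [claim: Joshi2023ATS2half, status: disputed] -/
def logCoords (y : D.Arith) (x : Lˣ) : V →₀ ℝ :=
  Finsupp.ofSupportFinite (fun v => Real.log (D.absK v (y v) (D.iota y v x)))
    ((D.finite_absK_iota_ne_one y x).subset fun v hv h1 => hv (by simp [h1]))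

/-- Coordinates of `logCoords`. [claim: Joshi2023ATS2half, status: disputed] -/
@[simp] theorem logCoords_apply (y : D.Arith) (x : Lˣ) (v : V) :
    D.logCoords y x v = Real.log (D.absK v (y v) (D.iota y v x)) := by
  simp [logCoords, Finsupp.ofSupportFinite_coe]

/-- **[J-2½] Thm. 5.10.1 (4)** (p.38 l.24–41): «explicitly, the product formula hyperplane `H_y ⊂ ⊕_v ℝ` is given by
`H_y = {z = (z_v) : Σ_v α_v·z_v = 0}` [the sum is well-defined because all but finitely many `z_v = 0`]». [claim:
Joshi2023ATS2half, status: disputed] -/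
def hyperplane (y : D.Arith) : Set (V →₀ ℝ) := {z | (z.sum fun v r => D.α v (y v) * r) = 0}

/-- **[J-2½] Thm. 5.10.1 (3)** DERIVED (p.38 l.10–23: «each normalized arithmeticoid provides a hyperplane `H_y ⊂ V_L` given by the
logarithm of the product formula (5.3.4) … `H_y : log_y(L*) = 0`»): the unweighted log vector of every `x ∈ L*` lies on `H_y`.
[claim: Joshi2023ATS2half, status: disputed] -/
theorem logCoords_mem_hyperplane (y : D.Arith) (x : Lˣ) : D.logCoords y x ∈ D.hyperplane y := by
  simp only [hyperplane, Set.mem_setOf_eq, Finsupp.sum]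
  have hsub : (Function.support fun v => D.α v (y v) * Real.log (D.absK v (y v) (D.iota y v x))) ⊆
      ↑(D.logCoords y x).support := by
    intro v hv
    simp only [Function.mem_support, ne_eq, mul_eq_zero, not_or] at hv
    simpa [Finsupp.mem_support_iff] using hv.2
  have := D.prod_formula_normalized y x
  rw [finsum_eq_sum_of_support_subset _ hsub] at this
  simpa using this

/-- The two printed placements of `α` agree: the sum of the coordinates of `log_y(ι(x))` ((1)–(2)) is the `α`-weighted sum of
the unweighted coordinates ((4)). DERIVED. [claim: Joshi2023ATS2half, status: disputed] -/
theorem sum_logMap_eq_weighted_logCoords (y : D.Arith) (x : Lˣ) :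
    ((D.logMap y ⟨D.iotaUnits y x, D.iotaUnits_mem_ideloid y x⟩).sum fun _ r => r) =
      (D.logCoords y x).sum fun v r => D.α v (y v) * r := by
  rw [← deg_eq_sum_logMap, deg_iotaUnits]
  have h := D.logCoords_mem_hyperplane y x
  simp only [hyperplane, Set.mem_setOf_eq] at h
  exact h.symm

/-- **[J-2½] Thm. 5.10.1 (7)** (p.38 l.48–53): «the PERIOD MAPPING of the Arithmetic Teichmüller Theory of the number field `L`,
`𝒴_L → ℙ(V_L)`, `y ↦ H_y`, which associates to an arithmeticoid the hyperplane `H_y`» (valued in hyperplanes of `V_L`; (8): its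
image `ℙ(𝒴_L)` «is equipped with a natural action of all the groups … which act on `𝒴_L`» — prose). [claim: Joshi2023ATS2half,
status: disputed] -/
def periodMap : D.Arith → Set (V →₀ ℝ) := D.hyperplane

/-- **[J-2½] Thm. 5.10.1 (6)** (p.38 l.46–47): «the action `L* ↷ 𝒴_L` of Theorem 4.2.3 moves `H_y` to `H_{x·y}`» — definitionally,
the period map of `x·y` is `H_{x·y}`. [claim: Joshi2023ATS2half, status: disputed] -/
theorem periodMap_unitAction (x : Lˣ) (y : D.Arith) : D.periodMap (D.unitAction x y) = D.hyperplane (D.unitAction x y) := rfl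

/-- **[J-2½] Thm. 5.10.1 (7), the assertion** (p.38 l.48–49, proof l.57–62): the period mapping is «natural and NON-CONSTANT» —
«immediate from the fact that normalizations of arithmeticoids do not carry over because locally at each prime `v ∈ V^non_L`,
valuations cannot be simultaneously normalized on `Y_{ℂ^♭_p,ℚ_p}`» (cf. (5.3.7) «`α_{y′} ≠ α_y` in general»). [claim:
Joshi2023ATS2half, status: disputed] -/
@[claim "Joshi2023ATS2half" "disputed"]
def PeriodMapNonconstant : Prop := ∃ y₁ y₂ : D.Arith, D.periodMap y₁ ≠ D.periodMap y₂

/-! ## §5.14 The Frobenioid associated to a number field (Def. 5.14.1) -/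

/-- **[J-2½] Def. 5.14.1, `Φ(L)`** (p.41 l.36–46): «`Φ(L) = ⊕_{v ∈ V_L} (𝒪^⊳_{L_v})/(𝒪*_{L_v})`» — at `v ∈ V^non`,
`𝒪^⊳_{L_v}/𝒪*_{L_v} ≅ (ℕ, +)` through `ord_v`, so `Φ(L)` is typed as the finitely supported NONNEGATIVE integer vectors on `V`
vanishing on `V^arc` (LOCATED: print's sum runs over all `v ∈ V_L`; for `v ∈ V^arc`, `L_v ≃ ℂ` and `𝒪_{L_v}` is not defined
in the paper). [claim: Joshi2023ATS2half, status: disputed] -/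
def PhiL : AddSubmonoid (V →₀ ℤ) where
  carrier := {f | (∀ v, 0 ≤ f v) ∧ ∀ v, v ∈ D.Varc → f v = 0}
  add_mem' hf hg := ⟨fun v => by simpa using add_nonneg (hf.1 v) (hg.1 v), fun v hv => by simp [hf.2 v hv, hg.2 v hv]⟩
  zero_mem' := ⟨fun _ => le_rfl, fun _ _ => rfl⟩

/-- **[J-2½] Def. 5.14.1, `Φ(L)^gp`** (p.41 l.47–53): «`Φ(L)^gp = ⊕_{v ∈ V_L} L_v*/𝒪*_{L_v}`» — finitely supported integer
vectors vanishing on `V^arc`. [claim: Joshi2023ATS2half, status: disputed] -/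
def PhiLgp : AddSubgroup (V →₀ ℤ) where
  carrier := {f | ∀ v, v ∈ D.Varc → f v = 0}
  add_mem' hf hg := fun v hv => by simp [hf v hv, hg v hv]
  zero_mem' := fun _ _ => rfl
  neg_mem' hf := fun v hv => by simp [hf v hv]

/-- **[J-2½] Def. 5.14.1, the map `L* → Φ(L)^gp`** (p.41 l.47–53: «the natural homomorphism» `x ↦ (x mod 𝒪*_{L_v})_v`): in
coordinates `x ↦ (ord_v(x))_v`, a homomorphism `L* → ∏_v ℤ` (its finite support — (5.3.1) together with
`|x|_v = q_v^{−ord_v(x)}` — is a standard fact the signature does not carry; so the map is typed into the full product).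
`Frob(L) := (L*, Φ(L), L* → Φ(L)^gp)` is the triple (`Lˣ`, `PhiL`, `divL`). [claim: Joshi2023ATS2half, status: disputed] -/
def divL : Lˣ →* ((v : V) → Multiplicative ℤ) := MonoidHom.pi fun v => D.ord v

/-- `divL` has trivial archimedean coordinates. [claim: Joshi2023ATS2half, status: disputed] -/
theorem divL_arch (x : Lˣ) {v : V} (hv : v ∈ D.Varc) : D.divL x v = 1 := by
  simp [divL, D.ord_arch v hv]

end DeformationDatum

end Summit.ABC.IUTFork.Joshi.ATS2h
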